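import Literature.MathematicalPhysics.QuantumFieldTheory.Balaban1983to89.B6Repr2129

/-!
# `Balaban1983to89.B6Eq2144` — T. Bałaban, *Propagators and renormalization transformations for lattice gauge
# theories. II*, Commun. Math. Phys. **96** (1984) 223–250 [Balaban1984PropagatorsII], Sect. C (2.144)–(2.147) p. 248:
# the lower bound `⟨B,(QG_□Q*)↾_□B⟩ ≥ γ₀‖B‖²` of the operator `QGQ*`, PROVED from the two-scale representation (2.129)

statement-level skeleton of published theorems with citation tags; proofs where landed; nothing here is a claim about the Yang–Mills mass gap

PDF held: `paper:balaban1984-cmp96-propagators-rt-ii` (journal page = PDF page + 222); read AS IMAGES on the ×2 renders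
`run/shared/lean/pub/pub-balaban/b2b-balaban-ref1/pages/1984-cmp96-propagators-rt-II/…-p017 … -p026-x2.png` (pp. 239–248)
by this seat (2026-08-21).

CITATION HEADER (lean-in-tree rule).  WHAT IS REPRODUCED: lit-balaban SKELETON row **B6.Eq2.144** ((2.144)–(2.147)
p. 248; until now `typed-existing`: the undisplayed step *"‖B₁‖² is bounded from below by const‖B‖²"* was kernel-checked
in `…B6AdjointAveraging.p248_lower`, and (2.147) itself entered `…B6WeightedEncoding` / `…B6Sect5Closed` as the
displayed HYPOTHESIS `lower` / `h2144`); PHASE-2 seat p22 (gen 3); owner r03, referee ref-4.  CONTINUES this seat's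
`…B6Repr2129` ((2.129), gen 2), `…B6Eq2130` ((2.130)–(2.131): `Q_jH_j = I`, `Q_jG̃_j = 0`) and `…B6GaussianIdentity2119`
((2.119), gen 1) over the SAME abstract carriers and conventions of `…B6Eq295` §4 (a δ-function integral = an integral
over a linear parametrisation `ι` of the constraint surface against a left-invariant measure; *"a covariance of this
Gaussian integral"* = an operator `C = ι∘T` ranging in the constraint configurations and inverting the form there,
`⟨ιm, M(CK)⟩ = ⟨ιm, K⟩`).  Nothing of any existing module is restated or modified; `…B6Repr2129.cov_coercive`,
`…B6Repr2129.form_2120_symm`, `…B6Repr2129.eq2129_printed`, `…B6Eq2130.Q_hOp`, `…B6Eq2130.Q_tildeOp` are consumed by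
name.

PRINT (p. 248 [PDF 26], verbatim).  *"Finally let us consider the operator QGQ* and its inverse. We consider these
operators on the L²-space defined by (2.69) with sites replaced by bonds. The operator QGQ* is positive, hence the
inverse is well defined and positive also. … Keeping the same notations as before we consider the operators
C_□ = ((QG_□Q*)↾_□)⁻¹, C = Σ_{□∈𝒟} h_□C_□h_□. (2.143) At first let us investigate bounds on C_□. We assume that we have
the same geometric situation as previously, so
⟨B,(QG_□Q*)↾_□B⟩ = (L^jη)^{d+2}⟨B,(QG^ξ_□Q*)↾_□B⟩ = (L^jη)^{d+2}⟨Q″*B, Q_jG^ξ_□Q_j*Q″*B⟩, (2.144)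
where Q″ is defined, as in (2.119), by the quadratic form in B in the expression (2.112), and the last scalar product
above is on the unit scale. We put B equal to 0 outside □, and we omit the superscripts ξ and □ in the sequel. The
expression on the right-hand side in (2.144) is equal to ⟨Q*B, GQ*B⟩ and is defined by the integral in (2.95) with
⟨A, J⟩ replaced by ⟨A, Q*B⟩ = ⟨QA, B⟩. This expression is gauge-invariant with respect to gauge transformations given by
λ satisfying Q′λ = 0. In the calculations between (2.95) and (2.129) we made such transformations only, and we may drop
terms which appeared because of the non-invariance of ⟨A, J⟩. We obtain
⟨B,QGQ*B⟩ = ⟨B,QG̃_jQ*B⟩ + ⟨B,QH_jC̃^{(j)}_ΛH_j*Q*B⟩ = ⟨Q″*B,Q_jG̃_jQ_j*Q″*B⟩ + ⟨Q″*B,Q_jH_jC̃^{(j)}_ΛH_j*Q_j*Q″*B⟩. (2.145)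
The first term on the right-hand side of the last equality is equal to 0 by the definition of G̃_j. From the definition
of H_j we have Q_jH_j = I, hence ⟨B,QGQ*B⟩ = ⟨Q″*B, C̃^{(j)}_ΛQ″*B⟩ = ⟨B₁, C̃^{(j)}_ΛB₁⟩, (2.146) where B₁ is equal to
Q″*B everywhere except the bonds of ⋃_{y∈Λ′}Ax(y) at which it is equal to 0. The operator C̃^{(j)}_Λ is an inverse to
the operator of the quadratic form (2.120), hence it is bounded from below by an inverse of an upper bound of this form.
Taking into account that ‖B₁‖² is bounded from below by const‖B‖², we get ⟨B,(QG_□Q*)↾_□B⟩ ≥ γ₀‖B‖² (2.147) with a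
positive constant γ₀ depending on d and L only."*  The inputs quoted by the text: (2.129) p. 246
`⟨J,GJ⟩ = ⟨J,∂H′_jC^{(j)}_ΛH′_j*∂*J⟩ + ⟨J − ∂ΔH′_jC^{(j)}_ΛH′_j*∂*J,(G̃_j + H_jC̃^{(j)}_ΛH_j*)(J − ∂ΔH′_jC^{(j)}_ΛH′_j*∂*J)⟩`;
p. 241: *"Let us make a gauge transformation in the integral ∫dA… defined by the function λ₀ = H′_jω, A → A − ∂λ₀ =
A − ∂H′_jω. This transformation does not change the measure dA and in the first exponential only the term ⟨A,J⟩ is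
changed into ⟨A − ∂H′_jω, J⟩. According to (2.103) the δ-functions δ_{Ax(y)}(Q_jA + ∂₁ω) are changed into
δ_{Ax(y)}(Q_jA)"*, (2.104) *"μ = 0 on Λ^c, Q′₁μ = 0 on Λ′. This matches our needs exactly because the unit lattice gauge
functions ω appearing in the integral (2.97) satisfy the above conditions"*, and p. 241 bottom *"Q′λ₀ = Q′_jλ₀ = ω = 0 on
Λ^c, and Q′λ₀ = Q′_{j+1}λ₀ = Q′₁ω = 0 on Λ′"*; (2.110)–(2.111) p. 242 (the ω-integrals are Gaussian with a form bounded
below by `γ₀‖ω‖²` on `{Q′₁ω = 0}` and covariance `C^{(j)}_Λ`); p. 246 *"These forms are bounded from below by γ₀″‖B‖² …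
This implies that a covariance C̃^{(j)}_Λ of the Gaussian integral in (2.119) is bounded from above"*.

WHAT IS TYPED / PROVED (no deferred proofs; every hypothesis displayed; 0 definitions).
§1 `cov_apply_eq_zero` — a covariance `C = ι∘T` of a form coercive on the constraint configurations `ι(N)` KILLS every
   vector orthogonal to them (from `…B6Repr2129.cov_coercive`).  This is the one mechanism behind both *"we may drop
   terms"* (2.145) and *"B₁ … equal to 0"* on the axial bonds (2.146).
§2 *"we may drop terms which appeared because of the non-invariance of ⟨A,J⟩"*: the two operators of (2.111)/(2.129),
   `K₁ = ∂H′_j·C^{(j)}_Λ·H′_j*∂*` and `K₂ = ∂ΔH′_j·C^{(j)}_Λ·H′_j*∂*`, are typed STRUCTURED as `D₁∘C′∘V`, `D₂∘C′∘V` with the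
   common right factor `V = H′_j*∂*` (adjoint of `∂H′_j`, `hV`) and the ω-covariance `C′ = C^{(j)}_Λ = ι_ω∘T′` of the
   constrained ω-Gaussian (2.106)/(2.110); `drop_term`: they vanish on every source `J` with `⟨∂H′_jω, J⟩ = 0` for the
   constrained `ω`; `inv_source`: `J = Q*B` is such a source as soon as `Q(∂H′_jω) = 0` for those `ω` (`hgauge` — the
   printed (2.103)–(2.104) invariance `QA^{λ₀} = QA` of the two-scale averages); **`eq2145_of_2129`** ((2.145) line 1 at
   a gauge-invariant source), **`eq2144`** ((2.144)₂: `Q = Q″Q_j`, `Q* = Q_j*Q″*`), **`eq2145_line1`**, **`eq2145`** —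
   (2.145) AS PRINTED, both equalities.
§3 **`eq2146`** — (2.146) AS PRINTED: `Q_jG̃_j = 0` kills the first term, `Q_jH_j = I` collapses the second to
   `⟨Q″*B, C̃^{(j)}_ΛQ″*B⟩` (`Hjs_Qjs`: `H_j*Q_j* = (Q_jH_j)* = I`); **`eq2146_B1`** `= ⟨B₁, C̃^{(j)}_ΛB₁⟩` for
   `B₁ = P(Q″*B)`, `P` any linear map INTO the constraint configurations (2.121) with `K − PK ⊥` them (print: *"equal to
   Q″*B everywhere except the bonds of ⋃Ax(y) at which it is equal to 0"* — the coordinate projection) (by §1).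
§4 *"C̃^{(j)}_Λ is an inverse to the operator of the quadratic form (2.120), hence it is bounded from below by an inverse
   of an upper bound of this form"*: **`inner_cov_ge`** — form `≤ γ₁‖·‖²` (and `≥ 0`) on the constraint configurations
   ⇒ `⟨K, C̃K⟩ ≥ γ₁⁻¹‖PK‖²` (polarisation-free: `0 ≤ ⟨C̃K − γ₁⁻¹B₁, M(C̃K − γ₁⁻¹B₁)⟩`).
§5 **`ineq2147_of_2129`** — (2.147) from (2.129) taken for every source: with *"‖B₁‖² is bounded from below by
   const‖B‖²"* as the hypothesis `hB1 : c_B‖B‖² ≤ ‖P(Q″*B)‖²` (kernel-checked for the concrete bond sets with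
   `c_B = (2 + 2L^d + L^{2d}/w²)⁻¹` in `…B6AdjointAveraging.p248_lower`), `⟨B,QGQ*B⟩ ≥ γ₁⁻¹c_B‖B‖²` — i.e. (2.147) with
   **`γ₀ = c_B/γ₁` explicit**; **`ineq2147_printed`** — the same with THE printed operators `H_j = G_jQ_j*(Q_jG_jQ_j*)⁻¹`
   (2.130), `G̃_j = G_j − G_jQ_j*(…)⁻¹Q_jG_j` (2.131) (`Q_jH_j = I`, `Q_jG̃_j = 0` being `…B6Eq2130.Q_hOp`/`Q_tildeOp`),
   the form of (2.120) `Q″*aQ″ + Δ_j` (`…B6Repr2129.form_2120_symm`) and (2.129) supplied by `…B6Repr2129.eq2129_printed`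
   from (2.112) displayed for every source.
READINGS (none is an objection to print).  (a) (2.144) FIRST equality — the rescaling by `(L^jη)^{d+2}` from the
`L^jη`-lattice to the unit lattice — is the (2.94)/(2.80)-type bookkeeping (`…B6Eq294Scaling`), kept downstream as the
hypothesis `h2144`/`hscale` of `…B6Sect5Closed`/`…B6WeightedEncoding`; it is NOT re-derived here: everything below is
*"on the unit scale"* with *"the superscripts ξ and □"* omitted, as print does from (2.144) on.  (b) *"we may drop
terms"*: print argues by gauge invariance of the whole integral (2.95); the typed route is the equivalent term-wise
statement — for `J = Q*B` the factor `e^{−⟨∂H′_jω,J⟩}` of (2.105) is `1` (`⟨∂H′_jω, Q*B⟩ = ⟨Q∂H′_jω, B⟩ = 0` by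
(2.103)–(2.104)), so the source `H′_j*∂*J` of the ω-Gaussian (2.106) is orthogonal to the constrained `ω`'s and its
covariance image vanishes (§1), whence both `H′_j`-terms of (2.111)/(2.129) vanish.  The interface-bond subtlety of
(2.104) (which unit bonds count as bonds *"of Λ^c"*) lives entirely inside the hypothesis `hgauge` and inside the bond
sets fed to `p248_lower` (see that module's header (e)); nothing here depends on how it is settled.  (c) `γ₁` = *"an
upper bound of this form"* (2.120) on the configurations (2.121) is a hypothesis-constant (print: from (2.122) and
(2.118), depending on d and L only); positivity of the form there (`hpos`; p. 246 *"bounded from below by γ₀″‖B‖²"*,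
used with `γ₀″ > 0` only in `eq2146_B1`) is what makes (2.147) need no lower constant.  (d) `≤`/junk conventions of
`…B6Eq295`; (2.129)/(2.112) are displayed for an arbitrary source `J` and the hypotheses say so (`∀ J`).
Unit `lit-balaban-p22` (PHASE-2 proof seat, gen 3), HOME `run/shared/lean/pub/lit-balaban/`, 2026-08-21.
-/

noncomputable section

open MeasureTheory
open scoped InnerProductSpace

namespace Literature.MathematicalPhysics.QuantumFieldTheory.Balaban1983to89.B6Eq2144

/-! ## §1 A covariance kills the vectors orthogonal to its constraint configurations -/

section Cov

variable {X : Type*} [NormedAddCommGroup X] [InnerProductSpace ℝ X]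
variable {N : Type*} [AddCommGroup N] [Module ℝ N]

/-- **The mechanism of p. 248.**  Let `C = ι∘T` be *"a covariance"* of a Gaussian integral over the constraint
configurations `ι(N)` whose form `M` is bounded below there by `γ‖·‖²`, `γ > 0` (p. 246: *"bounded from below by
γ₀″‖B‖²"*; (2.110) for the ω-integrals): `⟨ιm, M(Cv)⟩ = ⟨ιm, v⟩`.  Then `C` kills every `v` orthogonal to the
constraint configurations: `Cv = 0`. [cite: Balaban1984PropagatorsII, (2.145)–(2.146) p.248] -/
theorem cov_apply_eq_zero (ι : N →ₗ[ℝ] X) (T : X →ₗ[ℝ] N) (M C : X →ₗ[ℝ] X) (γ : ℝ) (hγ : 0 < γ)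
    (hcoer : ∀ m : N, γ * ‖ι m‖ ^ 2 ≤ ⟪ι m, M (ι m)⟫_ℝ) (hC : ∀ v, C v = ι (T v))
    (hsol : ∀ (m : N) (v : X), ⟪ι m, M (C v)⟫_ℝ = ⟪ι m, v⟫_ℝ) (v : X) (hv : ∀ m : N, ⟪ι m, v⟫_ℝ = 0) :
    C v = 0 := by
  have h1 : γ * ‖C v‖ ^ 2 ≤ ⟪C v, v⟫_ℝ := B6Repr2129.cov_coercive ι T M C γ hcoer hC hsol v
  have h2 : ⟪C v, v⟫_ℝ = 0 := by
    rw [hC]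
    exact hv (T v)
  have h3 : ‖C v‖ ^ 2 ≤ 0 := by
    have h := h1.trans_eq h2
    nlinarith [sq_nonneg ‖C v‖, hγ]
  have h4 : ‖C v‖ = 0 := by nlinarith [norm_nonneg (C v)]
  exact norm_eq_zero.mp h4

end Cov

/-! ## §2 (2.144)₂ and (2.145): "we may drop terms which appeared because of the non-invariance of ⟨A, J⟩" -/

section Drop

variable {A : Type*} [NormedAddCommGroup A] [InnerProductSpace ℝ A]
variable {Om : Type*} [NormedAddCommGroup Om] [InnerProductSpace ℝ Om]
variable {NO : Type*} [AddCommGroup NO] [Module ℝ NO]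
variable {Bs : Type*} [NormedAddCommGroup Bs] [InnerProductSpace ℝ Bs]
variable {V : Type*} [NormedAddCommGroup V] [InnerProductSpace ℝ V]

/-- **One `H′_j`-term of (2.111)/(2.129) dropped.**  The operators `∂H′_jC^{(j)}_ΛH′_j*∂*` and `∂ΔH′_jC^{(j)}_ΛH′_j*∂*`
have the shape `D∘C′∘V` with `V = H′_j*∂*` and `C′ = C^{(j)}_Λ = ι_ω∘T′` the covariance of the constrained ω-Gaussian
(2.106) (form `M_ω` bounded below by `γ‖ω‖²` on the constrained `ω`, (2.110)).  If the source `J` satisfies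
`⟨ι_ωm, VJ⟩ = 0` for every constrained `ω = ι_ωm` (`hinv`: *"gauge-invariant with respect to gauge transformations given
by λ satisfying Q′λ = 0"*), then `(D∘C′∘V)J = 0`. [cite: Balaban1984PropagatorsII, (2.145) p.248] -/
theorem drop_term (ιO : NO →ₗ[ℝ] Om) (TO : Om →ₗ[ℝ] NO) (MO Cp : Om →ₗ[ℝ] Om) (γ : ℝ) (hγ : 0 < γ)
    (hcoer : ∀ m : NO, γ * ‖ιO m‖ ^ 2 ≤ ⟪ιO m, MO (ιO m)⟫_ℝ) (hCp : ∀ v, Cp v = ιO (TO v))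
    (hsol : ∀ (m : NO) (v : Om), ⟪ιO m, MO (Cp v)⟫_ℝ = ⟪ιO m, v⟫_ℝ)
    (Vv : A →ₗ[ℝ] Om) (D : Om →ₗ[ℝ] A) (J : A) (hinv : ∀ m : NO, ⟪ιO m, Vv J⟫_ℝ = 0) :
    (D ∘ₗ Cp ∘ₗ Vv) J = 0 := by
  simp only [LinearMap.coe_comp, Function.comp_apply]
  rw [cov_apply_eq_zero ιO TO MO Cp γ hγ hcoer hCp hsol (Vv J) hinv, map_zero]

/-- **The source `J = Q*B` is gauge invariant** (p. 248: *"⟨A, Q*B⟩ = ⟨QA, B⟩. This expression is gauge-invariant with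
respect to gauge transformations given by λ satisfying Q′λ = 0. In the calculations between (2.95) and (2.129) we made
such transformations only"*): with `V = H′_j*∂*` the adjoint of `∂H′_j = DH` (`hV`), `Q*` the adjoint of `Q` (`hQ`),
and the printed invariance `Q(∂H′_jω) = 0` of the averages under `λ₀ = H′_jω` for the constrained `ω` ((2.103)–(2.104),
`hgauge`): `⟨ι_ωm, V(Q*B)⟩ = ⟨Q∂H′_j ι_ωm, B⟩ = 0`. [cite: Balaban1984PropagatorsII, (2.103)–(2.104) p.241 + (2.145) p.248] -/
theorem inv_source {W : Type*} [NormedAddCommGroup W] [InnerProductSpace ℝ W]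
    (ιO : NO →ₗ[ℝ] Om) (Vv : A →ₗ[ℝ] Om) (DH : Om →ₗ[ℝ] A)
    (hV : ∀ (o : Om) (J : A), ⟪o, Vv J⟫_ℝ = ⟪DH o, J⟫_ℝ)
    (Q : A →ₗ[ℝ] W) (Qs : W →ₗ[ℝ] A) (hQ : ∀ (w : W) (v : A), ⟪Qs w, v⟫_ℝ = ⟪w, Q v⟫_ℝ)
    (hgauge : ∀ m : NO, Q (DH (ιO m)) = 0) (B : W) (m : NO) :
    ⟪ιO m, Vv (Qs B)⟫_ℝ = 0 := by
  rw [hV, real_inner_comm, hQ, hgauge, inner_zero_right]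

/-- **(2.145), first line, at a gauge-invariant source, from (2.129):** if (2.129) holds at `J` —
`⟨J,GJ⟩ = ⟨J,K₁J⟩ + ⟨J − K₂J,(G̃_j + H_jC̃^{(j)}_ΛH_j*)(J − K₂J)⟩` with `K₁ = ∂H′_j·C^{(j)}_Λ·H′_j*∂* = D₁∘C′∘V`,
`K₂ = ∂ΔH′_j·C^{(j)}_Λ·H′_j*∂* = D₂∘C′∘V` — and `J` is gauge invariant (`hinv`), then *"we may drop terms which appeared
because of the non-invariance of ⟨A, J⟩"*: `⟨J,GJ⟩ = ⟨J,G̃_jJ⟩ + ⟨J,H_jC̃^{(j)}_ΛH_j*J⟩`.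
[cite: Balaban1984PropagatorsII, (2.145) p.248] -/
theorem eq2145_of_2129 (ιO : NO →ₗ[ℝ] Om) (TO : Om →ₗ[ℝ] NO) (MO Cp : Om →ₗ[ℝ] Om) (γ : ℝ) (hγ : 0 < γ)
    (hcoer : ∀ m : NO, γ * ‖ιO m‖ ^ 2 ≤ ⟪ιO m, MO (ιO m)⟫_ℝ) (hCp : ∀ v, Cp v = ιO (TO v))
    (hsol : ∀ (m : NO) (v : Om), ⟪ιO m, MO (Cp v)⟫_ℝ = ⟪ιO m, v⟫_ℝ)
    (Vv : A →ₗ[ℝ] Om) (D₁ D₂ : Om →ₗ[ℝ] A) (G Gt : A →ₗ[ℝ] A) (Hj : Bs →ₗ[ℝ] A) (Ct : Bs →ₗ[ℝ] Bs)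
    (Hjs : A →ₗ[ℝ] Bs) (J : A)
    (h2129 : ⟪J, G J⟫_ℝ = ⟪J, (D₁ ∘ₗ Cp ∘ₗ Vv) J⟫_ℝ +
      ⟪J - (D₂ ∘ₗ Cp ∘ₗ Vv) J, (Gt + Hj ∘ₗ Ct ∘ₗ Hjs) (J - (D₂ ∘ₗ Cp ∘ₗ Vv) J)⟫_ℝ)
    (hinv : ∀ m : NO, ⟪ιO m, Vv J⟫_ℝ = 0) :
    ⟪J, G J⟫_ℝ = ⟪J, Gt J⟫_ℝ + ⟪J, Hj (Ct (Hjs J))⟫_ℝ := by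
  rw [drop_term ιO TO MO Cp γ hγ hcoer hCp hsol Vv D₁ J hinv, drop_term ιO TO MO Cp γ hγ hcoer hCp hsol Vv D₂ J hinv,
    inner_zero_right, zero_add, sub_zero] at h2129
  simpa only [LinearMap.add_apply, LinearMap.coe_comp, Function.comp_apply, inner_add_right] using h2129

/-- **(2.144), second equality:** for the two-scale averaging `Q = Q″Q_j` (so `Q* = Q_j*Q″*`, `Q″*` the adjoint of `Q″`
for *"the last scalar product … on the unit scale"*, `hQpp`) and any operator `X`,
`⟨B, QXQ*B⟩ = ⟨Q″*B, Q_jXQ_j*Q″*B⟩`. [cite: Balaban1984PropagatorsII, (2.144) p.248] -/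
theorem eq2144 (Qj : A →ₗ[ℝ] Bs) (Qjs : Bs →ₗ[ℝ] A) (Qpp : Bs →ₗ[ℝ] V) (Qpps : V →ₗ[ℝ] Bs)
    (hQpp : ∀ (v : V) (b : Bs), ⟪Qpps v, b⟫_ℝ = ⟪v, Qpp b⟫_ℝ) (X : A →ₗ[ℝ] A) (B : V) :
    ⟪B, (Qpp ∘ₗ Qj) (X ((Qjs ∘ₗ Qpps) B))⟫_ℝ = ⟪Qpps B, Qj (X (Qjs (Qpps B)))⟫_ℝ := by
  simp only [LinearMap.coe_comp, Function.comp_apply]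
  rw [hQpp]

/-- `Q* = Q_j*Q″*` is the adjoint of `Q = Q″Q_j`. [cite: Balaban1984PropagatorsII, (2.144) p.248] -/
theorem adjoint_comp (Qj : A →ₗ[ℝ] Bs) (Qjs : Bs →ₗ[ℝ] A) (Qpp : Bs →ₗ[ℝ] V) (Qpps : V →ₗ[ℝ] Bs)
    (hQj : ∀ (b : Bs) (v : A), ⟪Qjs b, v⟫_ℝ = ⟪b, Qj v⟫_ℝ)
    (hQpp : ∀ (v : V) (b : Bs), ⟪Qpps v, b⟫_ℝ = ⟪v, Qpp b⟫_ℝ) (x : V) (v : A) :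
    ⟪(Qjs ∘ₗ Qpps) x, v⟫_ℝ = ⟪x, (Qpp ∘ₗ Qj) v⟫_ℝ := by
  simp only [LinearMap.coe_comp, Function.comp_apply]
  rw [hQj, hQpp]

/-- **(2.145), first equality, for the two-scale `Q`:** from (2.129) displayed for every source `J` (p. 246) with its
`H′_j`-terms structured as in `eq2145_of_2129`, `Q = Q″Q_j`, and the printed gauge invariance (2.103)–(2.104) of the
averages (`hgauge : Q(∂H′_jω) = 0` for the constrained `ω`):
`⟨B,QGQ*B⟩ = ⟨B,QG̃_jQ*B⟩ + ⟨B,QH_jC̃^{(j)}_ΛH_j*Q*B⟩`. [cite: Balaban1984PropagatorsII, (2.145) p.248] -/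
theorem eq2145_line1 (ιO : NO →ₗ[ℝ] Om) (TO : Om →ₗ[ℝ] NO) (MO Cp : Om →ₗ[ℝ] Om) (γ : ℝ) (hγ : 0 < γ)
    (hcoer : ∀ m : NO, γ * ‖ιO m‖ ^ 2 ≤ ⟪ιO m, MO (ιO m)⟫_ℝ) (hCp : ∀ v, Cp v = ιO (TO v))
    (hsol : ∀ (m : NO) (v : Om), ⟪ιO m, MO (Cp v)⟫_ℝ = ⟪ιO m, v⟫_ℝ)
    (Vv : A →ₗ[ℝ] Om) (DH D₁ D₂ : Om →ₗ[ℝ] A) (hV : ∀ (o : Om) (J : A), ⟪o, Vv J⟫_ℝ = ⟪DH o, J⟫_ℝ)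
    (G Gt : A →ₗ[ℝ] A) (Hj : Bs →ₗ[ℝ] A) (Ct : Bs →ₗ[ℝ] Bs) (Hjs : A →ₗ[ℝ] Bs)
    (Qj : A →ₗ[ℝ] Bs) (Qjs : Bs →ₗ[ℝ] A) (Qpp : Bs →ₗ[ℝ] V) (Qpps : V →ₗ[ℝ] Bs)
    (hQj : ∀ (b : Bs) (v : A), ⟪Qjs b, v⟫_ℝ = ⟪b, Qj v⟫_ℝ)
    (hQpp : ∀ (v : V) (b : Bs), ⟪Qpps v, b⟫_ℝ = ⟪v, Qpp b⟫_ℝ)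
    (hgauge : ∀ m : NO, (Qpp ∘ₗ Qj) (DH (ιO m)) = 0)
    (h2129 : ∀ J : A, ⟪J, G J⟫_ℝ = ⟪J, (D₁ ∘ₗ Cp ∘ₗ Vv) J⟫_ℝ +
      ⟪J - (D₂ ∘ₗ Cp ∘ₗ Vv) J, (Gt + Hj ∘ₗ Ct ∘ₗ Hjs) (J - (D₂ ∘ₗ Cp ∘ₗ Vv) J)⟫_ℝ) (B : V) :
    ⟪B, (Qpp ∘ₗ Qj) (G ((Qjs ∘ₗ Qpps) B))⟫_ℝ =
      ⟪B, (Qpp ∘ₗ Qj) (Gt ((Qjs ∘ₗ Qpps) B))⟫_ℝ + ⟪B, (Qpp ∘ₗ Qj) (Hj (Ct (Hjs ((Qjs ∘ₗ Qpps) B))))⟫_ℝ := by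
  have hinv : ∀ m : NO, ⟪ιO m, Vv ((Qjs ∘ₗ Qpps) B)⟫_ℝ = 0 := fun m =>
    inv_source ιO Vv DH hV (Qpp ∘ₗ Qj) (Qjs ∘ₗ Qpps) (adjoint_comp Qj Qjs Qpp Qpps hQj hQpp) hgauge B m
  have hJ := eq2145_of_2129 ιO TO MO Cp γ hγ hcoer hCp hsol Vv D₁ D₂ G Gt Hj Ct Hjs ((Qjs ∘ₗ Qpps) B)
    (h2129 _) hinv
  have e : ∀ y : A, ⟪B, (Qpp ∘ₗ Qj) y⟫_ℝ = ⟪(Qjs ∘ₗ Qpps) B, y⟫_ℝ := fun y =>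
    (adjoint_comp Qj Qjs Qpp Qpps hQj hQpp B y).symm
  rw [e, e, e]
  exact hJ

/-- **(2.145) AS PRINTED (first member = last member):**
`⟨B,QGQ*B⟩ = ⟨Q″*B,Q_jG̃_jQ_j*Q″*B⟩ + ⟨Q″*B,Q_jH_jC̃^{(j)}_ΛH_j*Q_j*Q″*B⟩` (hypotheses as in `eq2145_line1`; the middle
member is `eq2145_line1`, the second equality is `eq2144` termwise). [cite: Balaban1984PropagatorsII, (2.145) p.248] -/
theorem eq2145 (ιO : NO →ₗ[ℝ] Om) (TO : Om →ₗ[ℝ] NO) (MO Cp : Om →ₗ[ℝ] Om) (γ : ℝ) (hγ : 0 < γ)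
    (hcoer : ∀ m : NO, γ * ‖ιO m‖ ^ 2 ≤ ⟪ιO m, MO (ιO m)⟫_ℝ) (hCp : ∀ v, Cp v = ιO (TO v))
    (hsol : ∀ (m : NO) (v : Om), ⟪ιO m, MO (Cp v)⟫_ℝ = ⟪ιO m, v⟫_ℝ)
    (Vv : A →ₗ[ℝ] Om) (DH D₁ D₂ : Om →ₗ[ℝ] A) (hV : ∀ (o : Om) (J : A), ⟪o, Vv J⟫_ℝ = ⟪DH o, J⟫_ℝ)
    (G Gt : A →ₗ[ℝ] A) (Hj : Bs →ₗ[ℝ] A) (Ct : Bs →ₗ[ℝ] Bs) (Hjs : A →ₗ[ℝ] Bs)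
    (Qj : A →ₗ[ℝ] Bs) (Qjs : Bs →ₗ[ℝ] A) (Qpp : Bs →ₗ[ℝ] V) (Qpps : V →ₗ[ℝ] Bs)
    (hQj : ∀ (b : Bs) (v : A), ⟪Qjs b, v⟫_ℝ = ⟪b, Qj v⟫_ℝ)
    (hQpp : ∀ (v : V) (b : Bs), ⟪Qpps v, b⟫_ℝ = ⟪v, Qpp b⟫_ℝ)
    (hgauge : ∀ m : NO, (Qpp ∘ₗ Qj) (DH (ιO m)) = 0)
    (h2129 : ∀ J : A, ⟪J, G J⟫_ℝ = ⟪J, (D₁ ∘ₗ Cp ∘ₗ Vv) J⟫_ℝ +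
      ⟪J - (D₂ ∘ₗ Cp ∘ₗ Vv) J, (Gt + Hj ∘ₗ Ct ∘ₗ Hjs) (J - (D₂ ∘ₗ Cp ∘ₗ Vv) J)⟫_ℝ) (B : V) :
    ⟪B, (Qpp ∘ₗ Qj) (G ((Qjs ∘ₗ Qpps) B))⟫_ℝ =
      ⟪Qpps B, Qj (Gt (Qjs (Qpps B)))⟫_ℝ + ⟪Qpps B, Qj (Hj (Ct (Hjs (Qjs (Qpps B)))))⟫_ℝ := by
  rw [eq2145_line1 ιO TO MO Cp γ hγ hcoer hCp hsol Vv DH D₁ D₂ hV G Gt Hj Ct Hjs Qj Qjs Qpp Qpps hQj hQpp hgauge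
    h2129 B]
  simp only [LinearMap.coe_comp, Function.comp_apply]
  rw [hQpp, hQpp]

end Drop

/-! ## §3 (2.146): "The first term … is equal to 0 by the definition of G̃_j. … Q_jH_j = I, hence …" -/

section TwoTerms

variable {A : Type*} [NormedAddCommGroup A] [InnerProductSpace ℝ A]
variable {Bs : Type*} [NormedAddCommGroup Bs] [InnerProductSpace ℝ Bs]
variable {NB : Type*} [AddCommGroup NB] [Module ℝ NB]

/-- `Q_jH_j = I` transposed: `H_j*Q_j* = I` (`H_j*`, `Q_j*` the adjoints). [cite: Balaban1984PropagatorsII, (2.146) p.248] -/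
theorem Hjs_Qjs (Qj : A →ₗ[ℝ] Bs) (Qjs : Bs →ₗ[ℝ] A) (hQj : ∀ (b : Bs) (v : A), ⟪Qjs b, v⟫_ℝ = ⟪b, Qj v⟫_ℝ)
    (Hj : Bs →ₗ[ℝ] A) (Hjs : A →ₗ[ℝ] Bs) (hadj : ∀ (b : Bs) (x : A), ⟪Hj b, x⟫_ℝ = ⟪b, Hjs x⟫_ℝ)
    (hQH : ∀ b : Bs, Qj (Hj b) = b) (X : Bs) : Hjs (Qjs X) = X := by
  refine ext_inner_left ℝ fun v => ?_
  rw [← hadj, real_inner_comm (Qjs X) (Hj v), hQj, hQH]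
  exact real_inner_comm v X

/-- **(2.146), first equality:** `⟨Q″*B,Q_jG̃_jQ_j*Q″*B⟩ + ⟨Q″*B,Q_jH_jC̃^{(j)}_ΛH_j*Q_j*Q″*B⟩ = ⟨Q″*B, C̃^{(j)}_ΛQ″*B⟩` —
*"The first term … is equal to 0 by the definition of G̃_j"* (`Q_jG̃_j = 0`, `hQGt`; for the printed (2.131) this is
`…B6Eq2130.Q_tildeOp`) and *"From the definition of H_j we have Q_jH_j = I"* (`hQH`; `…B6Eq2130.Q_hOp`), stated for an
arbitrary unit-lattice field `X` in place of `Q″*B`. [cite: Balaban1984PropagatorsII, (2.146) p.248] -/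
theorem eq2146 (Qj : A →ₗ[ℝ] Bs) (Qjs : Bs →ₗ[ℝ] A) (hQj : ∀ (b : Bs) (v : A), ⟪Qjs b, v⟫_ℝ = ⟪b, Qj v⟫_ℝ)
    (Gt : A →ₗ[ℝ] A) (Hj : Bs →ₗ[ℝ] A) (Hjs : A →ₗ[ℝ] Bs)
    (hadj : ∀ (b : Bs) (x : A), ⟪Hj b, x⟫_ℝ = ⟪b, Hjs x⟫_ℝ) (Ct : Bs →ₗ[ℝ] Bs)
    (hQGt : ∀ x : A, Qj (Gt x) = 0) (hQH : ∀ b : Bs, Qj (Hj b) = b) (X : Bs) :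
    ⟪X, Qj (Gt (Qjs X))⟫_ℝ + ⟪X, Qj (Hj (Ct (Hjs (Qjs X))))⟫_ℝ = ⟪X, Ct X⟫_ℝ := by
  rw [hQGt, inner_zero_right, zero_add, Hjs_Qjs Qj Qjs hQj Hj Hjs hadj hQH X, hQH]

/-- **(2.146), second equality: `⟨Q″*B, C̃^{(j)}_ΛQ″*B⟩ = ⟨B₁, C̃^{(j)}_ΛB₁⟩`**, *"where B₁ is equal to Q″*B everywhere
except the bonds of ⋃_{y∈Λ′}Ax(y) at which it is equal to 0"*.  Typed: `B₁ = PK` for ANY linear `P` into the constraint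
configurations (2.121) (`hP1`) with `K − PK` orthogonal to them (`hP2`) — the coordinate projection of print — and
`C̃^{(j)}_Λ = ι_B∘T_B` a covariance of a form `M_B` bounded below by `γ‖·‖²`, `γ > 0`, there (p. 246, `γ = γ₀″`): the
covariance kills `K − PK` (§1) and ranges in the configurations. [cite: Balaban1984PropagatorsII, (2.146) p.248] -/
theorem eq2146_B1 (ιB : NB →ₗ[ℝ] Bs) (TB : Bs →ₗ[ℝ] NB) (MB Ct : Bs →ₗ[ℝ] Bs) (γ : ℝ) (hγ : 0 < γ)
    (hcoer : ∀ m : NB, γ * ‖ιB m‖ ^ 2 ≤ ⟪ιB m, MB (ιB m)⟫_ℝ) (hCt : ∀ K, Ct K = ιB (TB K))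
    (hCsol : ∀ (m : NB) (K : Bs), ⟪ιB m, MB (Ct K)⟫_ℝ = ⟪ιB m, K⟫_ℝ)
    (P : Bs →ₗ[ℝ] Bs) (hP1 : ∀ K, ∃ m, P K = ιB m) (hP2 : ∀ (K : Bs) (m : NB), ⟪K - P K, ιB m⟫_ℝ = 0) (K : Bs) :
    ⟪K, Ct K⟫_ℝ = ⟪P K, Ct (P K)⟫_ℝ := by
  obtain ⟨m₁, hm₁⟩ := hP1 K
  have h1 : Ct (K - P K) = 0 :=
    cov_apply_eq_zero ιB TB MB Ct γ hγ hcoer hCt hCsol (K - P K) fun m => by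
      rw [real_inner_comm]
      exact hP2 K m
  have h2 : Ct K = Ct (P K) := by
    rw [← sub_eq_zero, ← map_sub, h1]
  have h3 : ⟪K - P K, Ct (P K)⟫_ℝ = 0 := by
    rw [hCt]
    exact hP2 K _
  rw [inner_sub_left, sub_eq_zero] at h3
  rw [h2, h3]

end TwoTerms

/-! ## §4 "C̃^{(j)}_Λ … is bounded from below by an inverse of an upper bound of this form" -/

section LowerBound

variable {Bs : Type*} [NormedAddCommGroup Bs] [InnerProductSpace ℝ Bs]
variable {NB : Type*} [AddCommGroup NB] [Module ℝ NB]

/-- **p. 248: *"The operator C̃^{(j)}_Λ is an inverse to the operator of the quadratic form (2.120), hence it is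
bounded from below by an inverse of an upper bound of this form."***  Typed: `C̃ = ι_B∘T_B` a covariance
(`⟨ι_Bm, M_B(C̃K)⟩ = ⟨ι_Bm, K⟩`) of a symmetric form `M_B` that is `≥ 0` and `≤ γ₁‖·‖²` on the constraint configurations
`ι_B(N_B)`; `B₁ = PK` the projection INTO them (`hP1`, `hP2`).  Then `⟨K, C̃K⟩ ≥ γ₁⁻¹‖B₁‖²`.  (Proof: expand
`0 ≤ ⟨C̃K − γ₁⁻¹B₁, M_B(C̃K − γ₁⁻¹B₁)⟩` using `⟨C̃K, M_BC̃K⟩ = ⟨K, C̃K⟩`, `⟨B₁, M_BC̃K⟩ = ⟨B₁, K⟩ = ‖B₁‖²`,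
`⟨B₁, M_BB₁⟩ ≤ γ₁‖B₁‖²`.) [cite: Balaban1984PropagatorsII, (2.146)–(2.147) p.248] -/
theorem inner_cov_ge (ιB : NB →ₗ[ℝ] Bs) (TB : Bs →ₗ[ℝ] NB) (MB Ct : Bs →ₗ[ℝ] Bs) (γ₁ : ℝ) (hγ₁ : 0 < γ₁)
    (hMB : ∀ x y : Bs, ⟪MB x, y⟫_ℝ = ⟪x, MB y⟫_ℝ) (hpos : ∀ m : NB, 0 ≤ ⟪ιB m, MB (ιB m)⟫_ℝ)
    (hupper : ∀ m : NB, ⟪ιB m, MB (ιB m)⟫_ℝ ≤ γ₁ * ‖ιB m‖ ^ 2)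
    (hCt : ∀ K, Ct K = ιB (TB K)) (hCsol : ∀ (m : NB) (K : Bs), ⟪ιB m, MB (Ct K)⟫_ℝ = ⟪ιB m, K⟫_ℝ)
    (P : Bs →ₗ[ℝ] Bs) (hP1 : ∀ K, ∃ m, P K = ιB m) (hP2 : ∀ (K : Bs) (m : NB), ⟪K - P K, ιB m⟫_ℝ = 0) (K : Bs) :
    γ₁⁻¹ * ‖P K‖ ^ 2 ≤ ⟪K, Ct K⟫_ℝ := by
  obtain ⟨m₁, hm₁⟩ := hP1 K
  -- ⟨C̃K, M C̃K⟩ = ⟨K, C̃K⟩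
  have e1 : ⟪Ct K, MB (Ct K)⟫_ℝ = ⟪K, Ct K⟫_ℝ := by
    have h := hCsol (TB K) K
    rw [← hCt] at h
    rw [h, real_inner_comm]
  -- ⟨B₁, M C̃K⟩ = ⟨B₁, K⟩ = ‖B₁‖²
  have e2 : ⟪P K, MB (Ct K)⟫_ℝ = ‖P K‖ ^ 2 := by
    have h := hCsol m₁ K
    rw [← hm₁] at h
    have h' := hP2 K m₁
    rw [← hm₁, inner_sub_left, sub_eq_zero, real_inner_self_eq_norm_sq] at h'
    rw [h, real_inner_comm K (P K), h']
  -- ⟨B₁, M B₁⟩ ≤ γ₁‖B₁‖²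
  have e3 : ⟪P K, MB (P K)⟫_ℝ ≤ γ₁ * ‖P K‖ ^ 2 := by
    have h := hupper m₁
    rwa [← hm₁] at h
  -- the cross term is symmetric
  have e4 : ⟪Ct K, MB (P K)⟫_ℝ = ⟪P K, MB (Ct K)⟫_ℝ := by
    rw [← hMB, real_inner_comm]
  -- positivity of the form at C̃K − γ₁⁻¹B₁, a constraint configuration
  have e5 : 0 ≤ ⟪Ct K - γ₁⁻¹ • P K, MB (Ct K - γ₁⁻¹ • P K)⟫_ℝ := by
    have h := hpos (TB K - γ₁⁻¹ • m₁)
    rwa [map_sub, map_smul, ← hCt, ← hm₁] at h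
  have e6 : ⟪Ct K - γ₁⁻¹ • P K, MB (Ct K - γ₁⁻¹ • P K)⟫_ℝ =
      ⟪Ct K, MB (Ct K)⟫_ℝ - γ₁⁻¹ * ⟪Ct K, MB (P K)⟫_ℝ - γ₁⁻¹ * ⟪P K, MB (Ct K)⟫_ℝ
        + γ₁⁻¹ * γ₁⁻¹ * ⟪P K, MB (P K)⟫_ℝ := by
    simp only [map_sub, map_smul, inner_sub_left, inner_sub_right, real_inner_smul_left, real_inner_smul_right]
    ring
  rw [e6, e4, e2, e1] at e5
  have hi : 0 ≤ γ₁⁻¹ := inv_nonneg.mpr hγ₁.le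
  have e7 : γ₁⁻¹ * γ₁⁻¹ * ⟪P K, MB (P K)⟫_ℝ ≤ γ₁⁻¹ * ‖P K‖ ^ 2 := by
    calc γ₁⁻¹ * γ₁⁻¹ * ⟪P K, MB (P K)⟫_ℝ ≤ γ₁⁻¹ * γ₁⁻¹ * (γ₁ * ‖P K‖ ^ 2) :=
          mul_le_mul_of_nonneg_left e3 (mul_nonneg hi hi)
      _ = γ₁⁻¹ * ‖P K‖ ^ 2 := by
          field_simp
  linarith

end LowerBound

/-! ## §5 (2.147): ⟨B,(QG_□Q*)↾_□B⟩ ≥ γ₀‖B‖², from (2.129) -/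

section Assembly

variable {A : Type*} [NormedAddCommGroup A] [InnerProductSpace ℝ A]
variable {Om : Type*} [NormedAddCommGroup Om] [InnerProductSpace ℝ Om]
variable {NO : Type*} [AddCommGroup NO] [Module ℝ NO]
variable {Bs : Type*} [NormedAddCommGroup Bs] [InnerProductSpace ℝ Bs]
variable {NB : Type*} [AddCommGroup NB] [Module ℝ NB]
variable {V : Type*} [NormedAddCommGroup V] [InnerProductSpace ℝ V]

/-- **(2.147) p. 248, PROVED from (2.129): `⟨B,QGQ*B⟩ ≥ γ₀‖B‖²` with `γ₀ = c_B/γ₁` explicit.**  Hypotheses, all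
displayed: the constrained ω-Gaussian of (2.106)/(2.110) (`ι_ω`, form `M_ω ≥ γ_ω‖·‖²` with `γ_ω > 0`, covariance
`C^{(j)}_Λ = C′ = ι_ω∘T′`) and the structure `K₁ = D₁∘C′∘V`, `K₂ = D₂∘C′∘V`, `V = (∂H′_j)*` of the two `H′_j`-terms of
(2.129); the printed gauge invariance `Q(∂H′_jω) = 0` of the two-scale averages `Q = Q″Q_j` for the constrained `ω`
((2.103)–(2.104), `hgauge`); `Q_j*`, `Q″*`, `H_j*` the adjoints; `Q_jG̃_j = 0`, `Q_jH_j = I` ((2.130)–(2.131)); the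
B-Gaussian of (2.119)–(2.121): constraint configurations `ι_B`, symmetric form `M_B` with `0 ≤ ⟨·,M_B·⟩ ≤ γ₁‖·‖²` there
(*"an upper bound of this form"*, `γ₁ > 0`), covariance `C̃^{(j)}_Λ = ι_B∘T_B`; `B₁ = P(Q″*B)` the projection into the
configurations; *"‖B₁‖² is bounded from below by const‖B‖²"* (`hB1`, constant `c_B` — `…B6AdjointAveraging.p248_lower`
for the concrete bond sets); and (2.129) displayed for every source `J`.  Conclusion: `γ₁⁻¹c_B‖B‖² ≤ ⟨B, QGQ*B⟩`.
[cite: Balaban1984PropagatorsII, (2.147) p.248] -/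
theorem ineq2147_of_2129
    (ιO : NO →ₗ[ℝ] Om) (TO : Om →ₗ[ℝ] NO) (MO Cp : Om →ₗ[ℝ] Om) (γO : ℝ) (hγO : 0 < γO)
    (hcoerO : ∀ m : NO, γO * ‖ιO m‖ ^ 2 ≤ ⟪ιO m, MO (ιO m)⟫_ℝ) (hCp : ∀ v, Cp v = ιO (TO v))
    (hsolO : ∀ (m : NO) (v : Om), ⟪ιO m, MO (Cp v)⟫_ℝ = ⟪ιO m, v⟫_ℝ)
    (Vv : A →ₗ[ℝ] Om) (DH D₁ D₂ : Om →ₗ[ℝ] A) (hV : ∀ (o : Om) (J : A), ⟪o, Vv J⟫_ℝ = ⟪DH o, J⟫_ℝ)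
    (G Gt : A →ₗ[ℝ] A) (Hj : Bs →ₗ[ℝ] A) (Hjs : A →ₗ[ℝ] Bs)
    (hadj : ∀ (b : Bs) (x : A), ⟪Hj b, x⟫_ℝ = ⟪b, Hjs x⟫_ℝ)
    (Qj : A →ₗ[ℝ] Bs) (Qjs : Bs →ₗ[ℝ] A) (hQj : ∀ (b : Bs) (v : A), ⟪Qjs b, v⟫_ℝ = ⟪b, Qj v⟫_ℝ)
    (hQGt : ∀ x : A, Qj (Gt x) = 0) (hQH : ∀ b : Bs, Qj (Hj b) = b)
    (Qpp : Bs →ₗ[ℝ] V) (Qpps : V →ₗ[ℝ] Bs) (hQpp : ∀ (v : V) (b : Bs), ⟪Qpps v, b⟫_ℝ = ⟪v, Qpp b⟫_ℝ)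
    (hgauge : ∀ m : NO, (Qpp ∘ₗ Qj) (DH (ιO m)) = 0)
    (ιB : NB →ₗ[ℝ] Bs) (TB : Bs →ₗ[ℝ] NB) (MB Ct : Bs →ₗ[ℝ] Bs) (γ₁ : ℝ) (hγ₁ : 0 < γ₁)
    (hMB : ∀ x y : Bs, ⟪MB x, y⟫_ℝ = ⟪x, MB y⟫_ℝ) (hpos : ∀ m : NB, 0 ≤ ⟪ιB m, MB (ιB m)⟫_ℝ)
    (hupper : ∀ m : NB, ⟪ιB m, MB (ιB m)⟫_ℝ ≤ γ₁ * ‖ιB m‖ ^ 2)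
    (hCt : ∀ K, Ct K = ιB (TB K)) (hCsol : ∀ (m : NB) (K : Bs), ⟪ιB m, MB (Ct K)⟫_ℝ = ⟪ιB m, K⟫_ℝ)
    (P : Bs →ₗ[ℝ] Bs) (hP1 : ∀ K, ∃ m, P K = ιB m) (hP2 : ∀ (K : Bs) (m : NB), ⟪K - P K, ιB m⟫_ℝ = 0)
    (cB : ℝ) (hB1 : ∀ B : V, cB * ‖B‖ ^ 2 ≤ ‖P (Qpps B)‖ ^ 2)
    (h2129 : ∀ J : A, ⟪J, G J⟫_ℝ = ⟪J, (D₁ ∘ₗ Cp ∘ₗ Vv) J⟫_ℝ +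
      ⟪J - (D₂ ∘ₗ Cp ∘ₗ Vv) J, (Gt + Hj ∘ₗ Ct ∘ₗ Hjs) (J - (D₂ ∘ₗ Cp ∘ₗ Vv) J)⟫_ℝ) (B : V) :
    γ₁⁻¹ * cB * ‖B‖ ^ 2 ≤ ⟪B, (Qpp ∘ₗ Qj) (G ((Qjs ∘ₗ Qpps) B))⟫_ℝ := by
  rw [eq2145 ιO TO MO Cp γO hγO hcoerO hCp hsolO Vv DH D₁ D₂ hV G Gt Hj Ct Hjs Qj Qjs Qpp Qpps hQj hQpp hgauge h2129 B,
    eq2146 Qj Qjs hQj Gt Hj Hjs hadj Ct hQGt hQH (Qpps B)]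
  have h3 := inner_cov_ge ιB TB MB Ct γ₁ hγ₁ hMB hpos hupper hCt hCsol P hP1 hP2 (Qpps B)
  calc γ₁⁻¹ * cB * ‖B‖ ^ 2 = γ₁⁻¹ * (cB * ‖B‖ ^ 2) := by ring
    _ ≤ γ₁⁻¹ * ‖P (Qpps B)‖ ^ 2 := mul_le_mul_of_nonneg_left (hB1 B) (inv_nonneg.mpr hγ₁.le)
    _ ≤ _ := h3

end Assembly

/-! ## §6 (2.147) with THE printed operators (2.130)–(2.131) and (2.129) supplied from (2.112) -/

section Printed

variable {A : Type*} [NormedAddCommGroup A] [InnerProductSpace ℝ A]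
variable {Om : Type*} [NormedAddCommGroup Om] [InnerProductSpace ℝ Om]
variable {NO : Type*} [AddCommGroup NO] [Module ℝ NO]
variable {N : Type*} [AddCommGroup N] [Module ℝ N] [MeasurableSpace N] [MeasurableAdd N]
variable {Bs : Type*} [NormedAddCommGroup Bs] [InnerProductSpace ℝ Bs]
variable {NB : Type*} [AddCommGroup NB] [Module ℝ NB] [MeasurableSpace NB] [MeasurableAdd NB]
variable {V : Type*} [NormedAddCommGroup V] [InnerProductSpace ℝ V]

/-- **(2.147) with the printed `H_j = G_jQ_j*(Q_jG_jQ_j*)⁻¹` (2.130), `G̃_j = G_j − G_jQ_j*(…)⁻¹Q_jG_j` (2.131), the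
printed form `Q″*aQ″ + Δ_j` of (2.120), and (2.129) DERIVED from (2.112)** (`…B6Repr2129.eq2129_printed`: (2.112)
displayed for every source `J` with its `H′_j`-operators `K₁ = D₁∘C′∘V`, `K₂ = D₂∘C′∘V`; `G_j` a right inverse of
`(Δ − ∂P_j∂*) + Q_j*a₁Q_j`, `E` a right inverse of `Q_jG_jQ_j*`, so that `Q_jH_j = I` and `Q_jG̃_j = 0` are the theorems
`…B6Eq2130.Q_hOp` / `Q_tildeOp`).  Conclusion: `γ₁⁻¹c_B‖B‖² ≤ ⟨B, QG_□Q*B⟩`, `Q = Q″Q_j`.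
[cite: Balaban1984PropagatorsII, (2.144)–(2.147) p.248] -/
theorem ineq2147_printed
    (ιO : NO →ₗ[ℝ] Om) (TO : Om →ₗ[ℝ] NO) (MO Cp : Om →ₗ[ℝ] Om) (γO : ℝ) (hγO : 0 < γO)
    (hcoerO : ∀ m : NO, γO * ‖ιO m‖ ^ 2 ≤ ⟪ιO m, MO (ιO m)⟫_ℝ) (hCp : ∀ v, Cp v = ιO (TO v))
    (hsolO : ∀ (m : NO) (v : Om), ⟪ιO m, MO (Cp v)⟫_ℝ = ⟪ιO m, v⟫_ℝ)
    (Vv : A →ₗ[ℝ] Om) (DH D₁ D₂ : Om →ₗ[ℝ] A) (hV : ∀ (o : Om) (J : A), ⟪o, Vv J⟫_ℝ = ⟪DH o, J⟫_ℝ)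
    (μ : Measure N) [μ.IsAddLeftInvariant] (ι : N →ₗ[ℝ] A) (T : A →ₗ[ℝ] N)
    (M Gj : A →ₗ[ℝ] A) (Qj : A →ₗ[ℝ] Bs) (Qjs : Bs →ₗ[ℝ] A) (a₁ E : Bs →ₗ[ℝ] Bs) (Hjs : A →ₗ[ℝ] Bs)
    (Δj : Bs →ₗ[ℝ] Bs)
    (hM : ∀ x y : A, ⟪M x, y⟫_ℝ = ⟪x, M y⟫_ℝ) (hQj : ∀ (b : Bs) (v : A), ⟪Qjs b, v⟫_ℝ = ⟪b, Qj v⟫_ℝ)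
    (hGj : (M + Qjs ∘ₗ a₁ ∘ₗ Qj) ∘ₗ Gj = LinearMap.id) (hE : (Qj ∘ₗ Gj ∘ₗ Qjs) ∘ₗ E = LinearMap.id)
    (hι : ∀ n, Qj (ι n) = 0) (hT : ∀ J, B6SectA.tildeOp Gj Qj Qjs E J = ι (T J))
    (hadj : ∀ (b : Bs) (x : A), ⟪B6SectA.hOp Gj Qjs E b, x⟫_ℝ = ⟪b, Hjs x⟫_ℝ)
    (h2118 : ∀ b : Bs, ⟪B6SectA.hOp Gj Qjs E b, M (B6SectA.hOp Gj Qjs E b)⟫_ℝ = ⟪b, Δj b⟫_ℝ)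
    (Qpp : Bs →ₗ[ℝ] V) (Qpps : V →ₗ[ℝ] Bs) (a : V →ₗ[ℝ] V)
    (hQpp : ∀ (v : V) (b : Bs), ⟪Qpps v, b⟫_ℝ = ⟪v, Qpp b⟫_ℝ) (ha : ∀ x y : V, ⟪a x, y⟫_ℝ = ⟪x, a y⟫_ℝ)
    (hΔj : ∀ x y : Bs, ⟪Δj x, y⟫_ℝ = ⟪x, Δj y⟫_ℝ)
    (hgauge : ∀ m : NO, (Qpp ∘ₗ Qj) (DH (ιO m)) = 0)
    (ν : Measure NB) [ν.IsAddLeftInvariant] (ιB : NB →ₗ[ℝ] Bs) (TB : Bs →ₗ[ℝ] NB) (Ct : Bs →ₗ[ℝ] Bs)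
    (γ₁ : ℝ) (hγ₁ : 0 < γ₁) (hpos : ∀ m : NB, 0 ≤ ⟪ιB m, (Qpps ∘ₗ a ∘ₗ Qpp + Δj) (ιB m)⟫_ℝ)
    (hupper : ∀ m : NB, ⟪ιB m, (Qpps ∘ₗ a ∘ₗ Qpp + Δj) (ιB m)⟫_ℝ ≤ γ₁ * ‖ιB m‖ ^ 2)
    (hCt : ∀ K, Ct K = ιB (TB K))
    (hCsol : ∀ (m : NB) (K : Bs), ⟪ιB m, (Qpps ∘ₗ a ∘ₗ Qpp + Δj) (Ct K)⟫_ℝ = ⟪ιB m, K⟫_ℝ)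
    (P : Bs →ₗ[ℝ] Bs) (hP1 : ∀ K, ∃ m, P K = ιB m) (hP2 : ∀ (K : Bs) (m : NB), ⟪K - P K, ιB m⟫_ℝ = 0)
    (cB : ℝ) (hB1 : ∀ B : V, cB * ‖B‖ ^ 2 ≤ ‖P (Qpps B)‖ ^ 2)
    (G : A →ₗ[ℝ] A) (c : ℝ)
    (h2112 : ∀ J : A, Real.exp ((1 / 2) * ⟪J, G J⟫_ℝ) =
      Real.exp ((1 / 2) * ⟪J, (D₁ ∘ₗ Cp ∘ₗ Vv) J⟫_ℝ) * c *
      ∫ m, Real.exp (-(1 / 2) * ⟪Qpp (ιB m), a (Qpp (ιB m))⟫_ℝ) *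
        (∫ n, Real.exp (-(1 / 2) * ⟪ι n + B6SectA.hOp Gj Qjs E (ιB m), M (ι n + B6SectA.hOp Gj Qjs E (ιB m))⟫_ℝ
          + ⟪ι n + B6SectA.hOp Gj Qjs E (ιB m), J - (D₂ ∘ₗ Cp ∘ₗ Vv) J⟫_ℝ) ∂μ) ∂ν)
    (B : V) :
    γ₁⁻¹ * cB * ‖B‖ ^ 2 ≤
      ⟪B, (Qpp ∘ₗ Qj) (G ((Qjs ∘ₗ Qpps) B))⟫_ℝ :=
  ineq2147_of_2129 ιO TO MO Cp γO hγO hcoerO hCp hsolO Vv DH D₁ D₂ hV G (B6SectA.tildeOp Gj Qj Qjs E)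
    (B6SectA.hOp Gj Qjs E) Hjs hadj Qj Qjs hQj (fun x => B6Eq2130.Q_tildeOp Gj Qj Qjs E hE x)
    (fun b => B6Eq2130.Q_hOp Gj Qj Qjs E hE b) Qpp Qpps hQpp hgauge ιB TB (Qpps ∘ₗ a ∘ₗ Qpp + Δj) Ct γ₁ hγ₁
    (B6Repr2129.form_2120_symm Qpp Qpps a Δj hQpp ha hΔj) hpos hupper hCt hCsol P hP1 hP2 cB hB1
    (fun J => B6Repr2129.eq2129_printed μ ι T M Gj Qj Qjs a₁ E Hjs Δj hM hQj hGj hE hι hT hadj h2118 ν ιB TB Qpp Qpps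
      a Ct hQpp ha hΔj hCt hCsol G (D₁ ∘ₗ Cp ∘ₗ Vv) (D₂ ∘ₗ Cp ∘ₗ Vv) c h2112 J) B

end Printed

end Literature.MathematicalPhysics.QuantumFieldTheory.Balaban1983to89.B6Eq2144

end
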